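import Mathlib.Tactic.Group
import Summits.MatrixMultiplication.MatrixMultiplication.Theses.GelfandPairHosts
import Summits.MatrixMultiplication.MatrixMultiplication.Theorems.GelfandPairHostsKillGlue
import Summits.MatrixMultiplication.MatrixMultiplication.Theorems.GelfandPairHostsAffineCapacity

/-!
# `GelfandHosting` (crux stmt-MatrixMultiplication-7381), line `birth`, stub `stub_saturatedTripleHosts`:
# the abelian-index obstruction

Negative-side support file of the line lead (2026-08-17); everything `sorry`-free, no new
definitions.  Notation: a finite group `G` acts on a finite set `X` (`N = |X|`),
`D = dim span {P_g}` is the host cost, `k = [G : B]` the index of an ABELIAN subgroup `B ≤ G`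
(no normality, regularity or transitivity of `B` is assumed).

* §1 `quotientDesign_capacity_le_index_sq` — every quotient-form design `(F, Hs, P)`
  (`(f'⁻¹ f h⁻¹ h') • p = p' ⇒ f = f' ∧ h = h' ∧ p = p'`) has `|F|·|Hs|·|P| ≤ N·k²`.
  This is the tree's `affineCapacity_proof` with its (unused) regularity hypothesis dropped:
  the injection `(f,h,p) ↦ (fB, hB, (α f (α h)⁻¹) • p)`, `α` a coset section.
* §2 `saturatedTriple_capacity_le_index_sq` — the same bound in the vocabulary of the stub
  `stub_saturatedTripleHosts` of line `birth`: a TPP triple `(S,T,U)` of `G` (Cohn–Umans 2003,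
  Def. 2.1 form) whose third leg is right-saturated by the stabiliser of `x₀` has
  `|S|·|T|·|U • x₀| ≤ N·k²` (via `F = S⁻¹`, `Hs = T⁻¹`, `P = U • x₀`).
* §3 `saturatedTriple_witness_index` — consequently a witness of the `∃`-body of
  `stub_saturatedTripleHosts` at exponent `ε` (transitive host, `D ≤ (|S||T||U•x₀|)^{(2+ε)/3}`)
  satisfies `N³ ≤ (N·k²)^{2+ε}`, i.e. `N^{1-ε} ≤ k^{4+2ε}` for EVERY abelian subgroup of index `k`:
  the hosts must have no abelian subgroup of index below `N^{(1-ε)/(4+2ε)}`.  This disposes, for the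
  stub, of every family named in the route with an abelian subgroup of bounded index — the
  transvection hosts `F₂ⁿ ⋊ T(W) ≅ F₂ⁿ⁻¹ ≀ C₂` (`k = 2`, `D = 2N-2`), all wreath hosts `A ≀ C_q`
  (`k = q`), generalized dihedral hosts (`k = 2`), and affine hosts `A ⋊ K` with `|K| = N^{o(1)}`:
  e.g. with `k = 2` and `ε ≤ 1/10` the inequality forces `N^{9/10} ≤ 2^{21/5}`, `N ≤ 25`.

These lemmas do not decide the stub or the crux (hosts all of whose abelian subgroups have index
`≥ N^{1/4}` and `D = N^{1+o(1)}` exist, e.g. `(S_q × A) ↷ [q] × A` with `q ≈ log N`); they delimit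
where a witness can live.
-/

-- the tree's namespace `Summit.MatrixMultiplication.MatrixMultiplication.…` repeats a component by design
set_option linter.dupNamespace false

namespace Summit.MatrixMultiplication.MatrixMultiplication.Theorems.GelfandHosting.Negative

open Summit.MatrixMultiplication.MatrixMultiplication.Theorems
  (affineCapacity_exists_coset_section killGlue_card_le_finrank)

/-! ## §1 Quotient-form designs against an abelian subgroup of index `k` -/

/-- **Abelian-index capacity bound (quotient form).** If `B ≤ G` is an abelian subgroup of the
finite group `G` acting on the finite set `X`, every quotient-form design `(F, Hs, P)` —
`(f'⁻¹ f h⁻¹ h') • p = p' ⇒ f = f' ∧ h = h' ∧ p = p'` — satisfies `|F|·|Hs|·|P| ≤ |X|·[G:B]²`.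
Injection `(f, h, p) ↦ (fB, hB, (α f (α h)⁻¹) • p)` into `(G ⧸ B) × (G ⧸ B) × X` for a coset
section `α`; commutativity of `B` turns a collision into an instance of the design condition
(Cohn–Umans 2003, Lemma 3.1, pigeonholed over coset pairs).  No regularity or transitivity of `B`
is needed (the tree's `affineCapacity_proof` carries such a hypothesis but does not use it). [folklore] -/
theorem quotientDesign_capacity_le_index_sq {G : Type} [Group G] [Fintype G] {X : Type} [Fintype X]
    [DecidableEq X] [MulAction G X] (B : Subgroup G) (F Hs : Finset G) (P : Finset X)
    (hcomm : ∀ a ∈ B, ∀ a' ∈ B, a * a' = a' * a)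
    (hdes : ∀ f ∈ F, ∀ f' ∈ F, ∀ h ∈ Hs, ∀ h' ∈ Hs, ∀ p ∈ P, ∀ p' ∈ P,
      (f'⁻¹ * f * h⁻¹ * h') • p = p' → f = f' ∧ h = h' ∧ p = p') :
    F.card * Hs.card * P.card ≤ Fintype.card X * B.index ^ 2 := by
  classical
  obtain ⟨α, hαA, hαq⟩ := affineCapacity_exists_coset_section B
  haveI : Fintype (G ⧸ B) := Fintype.ofFinite (G ⧸ B)
  -- the injection
  let Φ : G × G × X → (G ⧸ B) × (G ⧸ B) × X :=
    fun t => (QuotientGroup.mk t.1, QuotientGroup.mk t.2.1, (α t.1 * (α t.2.1)⁻¹) • t.2.2)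
  have hinj : Set.InjOn Φ ↑(F ×ˢ (Hs ×ˢ P)) := by
    rintro ⟨f, h, p⟩ hm ⟨f', h', p'⟩ hm' heq
    simp only [Finset.coe_product, Set.mem_prod, Finset.mem_coe] at hm hm'
    obtain ⟨hf, hh, hp⟩ := hm
    obtain ⟨hf', hh', hp'⟩ := hm'
    simp only [Φ, Prod.mk.injEq] at heq
    obtain ⟨e1, e2, e3⟩ := heq
    have h1 : (α f')⁻¹ * α f = f'⁻¹ * f := hαq f f' e1
    have h2 : (α h)⁻¹ * α h' = h⁻¹ * h' := hαq h' h e2.symm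
    have h3 : ((α f' * (α h')⁻¹)⁻¹ * (α f * (α h)⁻¹)) • p = p' := by
      rw [mul_smul, e3, ← mul_smul, inv_mul_cancel, one_smul]
    have h4 : (α f' * (α h')⁻¹)⁻¹ * (α f * (α h)⁻¹) = f'⁻¹ * f * h⁻¹ * h' := by
      have c := hcomm (α h') (hαA h') ((α f')⁻¹ * α f * (α h)⁻¹)
        (B.mul_mem (B.mul_mem (B.inv_mem (hαA f')) (hαA f)) (B.inv_mem (hαA h)))
      calc (α f' * (α h')⁻¹)⁻¹ * (α f * (α h)⁻¹)
          = α h' * ((α f')⁻¹ * α f * (α h)⁻¹) := by group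
        _ = (α f')⁻¹ * α f * (α h)⁻¹ * α h' := c
        _ = ((α f')⁻¹ * α f) * ((α h)⁻¹ * α h') := by group
        _ = f'⁻¹ * f * h⁻¹ * h' := by rw [h1, h2]; group
    rw [h4] at h3
    obtain ⟨r1, r2, r3⟩ := hdes f hf f' hf' h hh h' hh' p hp p' hp' h3
    subst r1 r2 r3
    rfl
  have hcardq : Fintype.card (G ⧸ B) = B.index := by
    rw [Subgroup.index, Nat.card_eq_fintype_card]
  calc F.card * Hs.card * P.card
      = (F ×ˢ (Hs ×ˢ P)).card := by rw [Finset.card_product, Finset.card_product, mul_assoc]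
    _ = ((F ×ˢ (Hs ×ˢ P)).image Φ).card := (Finset.card_image_of_injOn hinj).symm
    _ ≤ Fintype.card ((G ⧸ B) × (G ⧸ B) × X) := Finset.card_le_univ _
    _ = Fintype.card X * B.index ^ 2 := by
        rw [Fintype.card_prod, Fintype.card_prod, hcardq]; ring

/-! ## §2 The same bound for stabiliser-saturated TPP triples (vocabulary of `stub_saturatedTripleHosts`) -/

/-- **From a saturated TPP triple to a quotient-form design.** If `(S, T, U)` has the triple
product property in `G` (Cohn–Umans 2003, Def. 2.1: `s s'⁻¹ (t t'⁻¹) (u u'⁻¹) = 1 ⇒ s = s', t = t',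
u = u'`) and `U` is right-saturated by the stabiliser of `x₀` (`u ∈ U`, `h • x₀ = x₀ ⇒ u h ∈ U`),
then `(F, Hs, P) = (S⁻¹, T⁻¹, U • x₀)` is a quotient-form design:
`(f'⁻¹ f h⁻¹ h') • p = p' ⇒ f = f' ∧ h = h' ∧ p = p'`. [folklore] -/
theorem quotientDesign_of_saturatedTriple {G : Type} [Group G] [DecidableEq G] {X : Type}
    [DecidableEq X] [MulAction G X] (x₀ : X) (S T U : Finset G)
    (htpp : ∀ s ∈ S, ∀ s' ∈ S, ∀ t ∈ T, ∀ t' ∈ T, ∀ u ∈ U, ∀ u' ∈ U,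
      s * s'⁻¹ * (t * t'⁻¹) * (u * u'⁻¹) = 1 → s = s' ∧ t = t' ∧ u = u')
    (hsat : ∀ u ∈ U, ∀ h : G, h • x₀ = x₀ → u * h ∈ U) :
    ∀ f ∈ S.image (·⁻¹), ∀ f' ∈ S.image (·⁻¹), ∀ h ∈ T.image (·⁻¹), ∀ h' ∈ T.image (·⁻¹),
      ∀ p ∈ U.image (· • x₀), ∀ p' ∈ U.image (· • x₀),
      (f'⁻¹ * f * h⁻¹ * h') • p = p' → f = f' ∧ h = h' ∧ p = p' := by
  intro f hf f' hf' h hh h' hh' p hp p' hp' heq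
  simp only [Finset.mem_image] at hf hf' hh hh' hp hp'
  obtain ⟨s', hs', rfl⟩ := hf
  obtain ⟨s, hs, rfl⟩ := hf'
  obtain ⟨t, ht, rfl⟩ := hh
  obtain ⟨t', ht', rfl⟩ := hh'
  obtain ⟨u, hu, rfl⟩ := hp
  obtain ⟨u', hu', rfl⟩ := hp'
  -- `heq : (s⁻¹⁻¹ * s'⁻¹ * t⁻¹⁻¹ * t'⁻¹) • u • x₀ = u' • x₀`
  simp only [inv_inv] at heq
  set g : G := s * s'⁻¹ * t * t'⁻¹ with hg
  -- the element `η := u'⁻¹ g u` fixes `x₀`, so `u' η ∈ U` by saturation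
  have hη : (u'⁻¹ * g * u) • x₀ = x₀ := by
    rw [mul_smul, mul_smul, heq, inv_smul_smul]
  have hmem : u' * (u'⁻¹ * g * u) ∈ U := hsat u' hu' _ hη
  -- TPP instance `(s, s', t, t', u, u' η)`
  have hprod : s * s'⁻¹ * (t * t'⁻¹) * (u * (u' * (u'⁻¹ * g * u))⁻¹) = 1 := by
    rw [hg]; group
  obtain ⟨e1, e2, e3⟩ := htpp s hs s' hs' t ht t' ht' u hu _ hmem hprod
  subst e1 e2
  refine ⟨rfl, rfl, ?_⟩
  -- `u = u' η` gives `u • x₀ = u' • (η • x₀) = u' • x₀`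
  conv_lhs => rw [e3]
  rw [mul_smul, hη]

/-- **Abelian-index capacity bound for saturated TPP triples.** In the setting of
`stub_saturatedTripleHosts` (a TPP triple `(S,T,U)` of `G` with `U · G_{x₀} = U`), if `G` has an
abelian subgroup `B` of index `k`, then `|S|·|T|·|U • x₀| ≤ |X|·k²`. [folklore] -/
theorem saturatedTriple_capacity_le_index_sq {G : Type} [Group G] [Fintype G] {X : Type}
    [Fintype X] [DecidableEq X] [MulAction G X] (B : Subgroup G)
    (hcomm : ∀ a ∈ B, ∀ a' ∈ B, a * a' = a' * a) (x₀ : X) (S T U : Finset G)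
    (htpp : ∀ s ∈ S, ∀ s' ∈ S, ∀ t ∈ T, ∀ t' ∈ T, ∀ u ∈ U, ∀ u' ∈ U,
      s * s'⁻¹ * (t * t'⁻¹) * (u * u'⁻¹) = 1 → s = s' ∧ t = t' ∧ u = u')
    (hsat : ∀ u ∈ U, ∀ h : G, h • x₀ = x₀ → u * h ∈ U) :
    S.card * T.card * (U.image fun u => u • x₀).card ≤ Fintype.card X * B.index ^ 2 := by
  classical
  have h := quotientDesign_capacity_le_index_sq B (S.image (·⁻¹)) (T.image (·⁻¹))
    (U.image (· • x₀)) hcomm (quotientDesign_of_saturatedTriple x₀ S T U htpp hsat)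
  rwa [Finset.card_image_of_injective _ inv_injective,
    Finset.card_image_of_injective _ inv_injective] at h

/-! ## §3 Consequence for witnesses of `stub_saturatedTripleHosts` -/

/-- **Witnesses of the stub need large minimal abelian index.** Let `G ↷ X` be transitive with a
TPP triple `(S,T,U)`, `U · G_{x₀} = U`, and host cost `D = dim span{P_g} ≤ (|S||T||U•x₀|)^{(2+ε)/3}`
(the `∃`-body of `stub_saturatedTripleHosts` at `ε`, generous transitivity weakened to
transitivity).  Then for every abelian subgroup `B ≤ G` of index `k`: `N³ ≤ (N·k²)^{2+ε}`, i.e.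
`N^{1-ε} ≤ k^{4+2ε}` — because `N ≤ D` for transitive actions (`killGlue_card_le_finrank`) and
`|S||T||U•x₀| ≤ N k²` (§2).  E.g. `k = 2`, `ε ≤ 1/10` forces `N ≤ 25`. [folklore] -/
theorem saturatedTriple_witness_index {G : Type} [Group G] [Fintype G] {X : Type} [Fintype X]
    [DecidableEq X] [MulAction G X] (B : Subgroup G)
    (hcomm : ∀ a ∈ B, ∀ a' ∈ B, a * a' = a' * a) (x₀ : X) (S T U : Finset G) (ε : ℝ) (hε : 0 < ε)
    (htrans : ∀ x y : X, ∃ g : G, g • x = y)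
    (htpp : ∀ s ∈ S, ∀ s' ∈ S, ∀ t ∈ T, ∀ t' ∈ T, ∀ u ∈ U, ∀ u' ∈ U,
      s * s'⁻¹ * (t * t'⁻¹) * (u * u'⁻¹) = 1 → s = s' ∧ t = t' ∧ u = u')
    (hsat : ∀ u ∈ U, ∀ h : G, h • x₀ = x₀ → u * h ∈ U)
    (hD : (Module.finrank ℂ (Submodule.span ℂ (Set.range fun g : G =>
        Matrix.of fun y x : X => if g • x = y then (1 : ℂ) else 0)) : ℝ) ≤
      ((S.card * T.card * (U.image fun u => u • x₀).card : ℕ) : ℝ) ^ ((2 + ε) / 3)) :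
    (Fintype.card X : ℝ) ^ (3 : ℝ) ≤ ((Fintype.card X * B.index ^ 2 : ℕ) : ℝ) ^ (2 + ε) := by
  have hN : (Fintype.card X : ℝ) ≤ (Module.finrank ℂ (Submodule.span ℂ (Set.range fun g : G =>
      Matrix.of fun y x : X => if g • x = y then (1 : ℂ) else 0)) : ℝ) := by
    exact_mod_cast killGlue_card_le_finrank x₀ htrans
  have hcap : ((S.card * T.card * (U.image fun u => u • x₀).card : ℕ) : ℝ) ≤
      ((Fintype.card X * B.index ^ 2 : ℕ) : ℝ) := by
    exact_mod_cast saturatedTriple_capacity_le_index_sq B hcomm x₀ S T U htpp hsat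
  have hexp : 0 ≤ (2 + ε) / 3 := by positivity
  have h1 : (Fintype.card X : ℝ) ≤ ((Fintype.card X * B.index ^ 2 : ℕ) : ℝ) ^ ((2 + ε) / 3) :=
    hN.trans (hD.trans (Real.rpow_le_rpow (by positivity) hcap hexp))
  have h2 := Real.rpow_le_rpow (by positivity) h1 (show (0 : ℝ) ≤ 3 by norm_num)
  rw [← Real.rpow_mul (by positivity)] at h2
  have e : (2 + ε) / 3 * 3 = 2 + ε := by ring
  rwa [e] at h2

/-! ## §4 Sharpening: one abelian subgroup and its centraliser

The proof of §1 only uses that the `Hs`-differences lie in an ABELIAN subgroup `B₂` and that the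
`F`-differences lie in a subgroup `B₁` CENTRALISING `B₂` (no commutativity inside `B₁` is needed).
Taking `B₁ = C_G(B₂)` replaces the factor `[G:B]²` of §1 by `[G:B]·[G:C_G(B)]`; e.g. for a product
host `(K × A) ↷ Y × A` (`A` abelian regular, `B = A` central) the bound becomes `|K|·N` instead of
`|K|²·N`. -/

/-- **Two-subgroup capacity bound (quotient form).** Let `B₁, B₂ ≤ G` with `B₂` abelian and every
element of `B₁` commuting with every element of `B₂` (e.g. `B₁ = C_G(B₂)`).  Every quotient-form design
`(F, Hs, P)` satisfies `|F|·|Hs|·|P| ≤ |X|·[G:B₁]·[G:B₂]`: injection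
`(f, h, p) ↦ (fB₁, hB₂, (α₁ f (α₂ h)⁻¹) • p)` with coset sections `α₁, α₂`. [folklore] -/
theorem quotientDesign_capacity_le_index_mul_index {G : Type} [Group G] [Fintype G] {X : Type}
    [Fintype X] [DecidableEq X] [MulAction G X] (B₁ B₂ : Subgroup G) (F Hs : Finset G) (P : Finset X)
    (hcomm : ∀ a ∈ B₂, ∀ a' ∈ B₂, a * a' = a' * a) (hcent : ∀ x ∈ B₁, ∀ a ∈ B₂, x * a = a * x)
    (hdes : ∀ f ∈ F, ∀ f' ∈ F, ∀ h ∈ Hs, ∀ h' ∈ Hs, ∀ p ∈ P, ∀ p' ∈ P,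
      (f'⁻¹ * f * h⁻¹ * h') • p = p' → f = f' ∧ h = h' ∧ p = p') :
    F.card * Hs.card * P.card ≤ Fintype.card X * B₁.index * B₂.index := by
  classical
  obtain ⟨α, hαA, hαq⟩ := affineCapacity_exists_coset_section B₁
  obtain ⟨β, hβA, hβq⟩ := affineCapacity_exists_coset_section B₂
  haveI : Fintype (G ⧸ B₁) := Fintype.ofFinite (G ⧸ B₁)
  haveI : Fintype (G ⧸ B₂) := Fintype.ofFinite (G ⧸ B₂)
  let Φ : G × G × X → (G ⧸ B₁) × (G ⧸ B₂) × X :=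
    fun t => (QuotientGroup.mk t.1, QuotientGroup.mk t.2.1, (α t.1 * (β t.2.1)⁻¹) • t.2.2)
  have hinj : Set.InjOn Φ ↑(F ×ˢ (Hs ×ˢ P)) := by
    rintro ⟨f, h, p⟩ hm ⟨f', h', p'⟩ hm' heq
    simp only [Finset.coe_product, Set.mem_prod, Finset.mem_coe] at hm hm'
    obtain ⟨hf, hh, hp⟩ := hm
    obtain ⟨hf', hh', hp'⟩ := hm'
    simp only [Φ, Prod.mk.injEq] at heq
    obtain ⟨e1, e2, e3⟩ := heq
    have h1 : (α f')⁻¹ * α f = f'⁻¹ * f := hαq f f' e1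
    have h2 : (β h)⁻¹ * β h' = h⁻¹ * h' := hβq h' h e2.symm
    have h3 : ((α f' * (β h')⁻¹)⁻¹ * (α f * (β h)⁻¹)) • p = p' := by
      rw [mul_smul, e3, ← mul_smul, inv_mul_cancel, one_smul]
    have h4 : (α f' * (β h')⁻¹)⁻¹ * (α f * (β h)⁻¹) = f'⁻¹ * f * h⁻¹ * h' := by
      -- `β h'` commutes with `(α f')⁻¹ α f ∈ B₁` (centralising) and with `(β h)⁻¹ ∈ B₂` (abelian)
      have c1 := hcent ((α f')⁻¹ * α f) (B₁.mul_mem (B₁.inv_mem (hαA f')) (hαA f)) (β h') (hβA h')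
      have c2 := hcomm (β h') (hβA h') ((β h)⁻¹) (B₂.inv_mem (hβA h))
      calc (α f' * (β h')⁻¹)⁻¹ * (α f * (β h)⁻¹)
          = β h' * ((α f')⁻¹ * α f) * (β h)⁻¹ := by group
        _ = ((α f')⁻¹ * α f) * β h' * (β h)⁻¹ := by rw [← c1]
        _ = ((α f')⁻¹ * α f) * (β h' * (β h)⁻¹) := by group
        _ = ((α f')⁻¹ * α f) * ((β h)⁻¹ * β h') := by rw [c2]
        _ = f'⁻¹ * f * h⁻¹ * h' := by rw [h1, h2]; group
    rw [h4] at h3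
    obtain ⟨r1, r2, r3⟩ := hdes f hf f' hf' h hh h' hh' p hp p' hp' h3
    subst r1 r2 r3
    rfl
  have hq1 : Fintype.card (G ⧸ B₁) = B₁.index := by
    rw [Subgroup.index, Nat.card_eq_fintype_card]
  have hq2 : Fintype.card (G ⧸ B₂) = B₂.index := by
    rw [Subgroup.index, Nat.card_eq_fintype_card]
  calc F.card * Hs.card * P.card
      = (F ×ˢ (Hs ×ˢ P)).card := by rw [Finset.card_product, Finset.card_product, mul_assoc]
    _ = ((F ×ˢ (Hs ×ˢ P)).image Φ).card := (Finset.card_image_of_injOn hinj).symm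
    _ ≤ Fintype.card ((G ⧸ B₁) × (G ⧸ B₂) × X) := Finset.card_le_univ _
    _ = Fintype.card X * B₁.index * B₂.index := by
        rw [Fintype.card_prod, Fintype.card_prod, hq1, hq2]; ring

/-- **Centraliser form.** For an abelian subgroup `B ≤ G`, every quotient-form design satisfies
`|F|·|Hs|·|P| ≤ |X|·[G:C_G(B)]·[G:B]` (`C_G(B) = Subgroup.centralizer B`), sharpening §1 since
`B ≤ C_G(B)`. [folklore] -/
theorem quotientDesign_capacity_le_index_centralizer {G : Type} [Group G] [Fintype G] {X : Type}
    [Fintype X] [DecidableEq X] [MulAction G X] (B : Subgroup G) (F Hs : Finset G) (P : Finset X)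
    (hcomm : ∀ a ∈ B, ∀ a' ∈ B, a * a' = a' * a)
    (hdes : ∀ f ∈ F, ∀ f' ∈ F, ∀ h ∈ Hs, ∀ h' ∈ Hs, ∀ p ∈ P, ∀ p' ∈ P,
      (f'⁻¹ * f * h⁻¹ * h') • p = p' → f = f' ∧ h = h' ∧ p = p') :
    F.card * Hs.card * P.card ≤
      Fintype.card X * (Subgroup.centralizer (B : Set G)).index * B.index :=
  quotientDesign_capacity_le_index_mul_index (Subgroup.centralizer (B : Set G)) B F Hs P hcomm
    (fun _ hx a ha => (Subgroup.mem_centralizer_iff.mp hx a ha).symm) hdes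

/-- **Saturated TPP triples, centraliser form.** In the setting of `stub_saturatedTripleHosts`, for an
abelian subgroup `B ≤ G`: `|S|·|T|·|U • x₀| ≤ |X|·[G:C_G(B)]·[G:B]`. [folklore] -/
theorem saturatedTriple_capacity_le_index_centralizer {G : Type} [Group G] [Fintype G] {X : Type}
    [Fintype X] [DecidableEq X] [MulAction G X] (B : Subgroup G)
    (hcomm : ∀ a ∈ B, ∀ a' ∈ B, a * a' = a' * a) (x₀ : X) (S T U : Finset G)
    (htpp : ∀ s ∈ S, ∀ s' ∈ S, ∀ t ∈ T, ∀ t' ∈ T, ∀ u ∈ U, ∀ u' ∈ U,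
      s * s'⁻¹ * (t * t'⁻¹) * (u * u'⁻¹) = 1 → s = s' ∧ t = t' ∧ u = u')
    (hsat : ∀ u ∈ U, ∀ h : G, h • x₀ = x₀ → u * h ∈ U) :
    S.card * T.card * (U.image fun u => u • x₀).card ≤
      Fintype.card X * (Subgroup.centralizer (B : Set G)).index * B.index := by
  classical
  have h := quotientDesign_capacity_le_index_centralizer B (S.image (·⁻¹)) (T.image (·⁻¹))
    (U.image (· • x₀)) hcomm (quotientDesign_of_saturatedTriple x₀ S T U htpp hsat)
  rwa [Finset.card_image_of_injective _ inv_injective,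
    Finset.card_image_of_injective _ inv_injective] at h

end Summit.MatrixMultiplication.MatrixMultiplication.Theorems.GelfandHosting.Negative
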